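import Mathlib.FieldTheory.Galois.Basic
import HarnessLib

/-!
# The index of a fixing subgroup is the degree

Topic `FieldTheory/Galois`; theorems only.  For a normal extension `L/K` (possibly infinite) and a
finite Galois subextension `M/K`, the fixing subgroup `Gal(L/M) ≤ Gal(L/K)` has index `[M : K]`
(`index_fixingSubgroup_eq_finrank`: the restriction `Gal(L/K) → Gal(M/K)` is onto with kernel
`Gal(L/M)`).  Relative version `relIndex_fixingSubgroup_restrictScalars_eq_finrank`: for
`K ⊆ k ⊆ M ⊆ L` with `M/k` finite Galois, `[Gal(L/k) : Gal(L/M)] = [M : k]` inside `Gal(L/K)`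
(transport along Mathlib's `IntermediateField.fixingSubgroupEquiv : Gal(L/k) ≃* (L ≃ₐ[k] L)`).
This is the piece of the Galois correspondence used to turn "a cyclic layer `M/k` of degree `ℓ`"
into "a subgroup of index `ℓ` of `Gal(K̄/k)`" in towers inside an algebraic closure.

## References

* J. Neukirch, *Algebraic Number Theory*, Ch. IV §1, (1.2) (Galois correspondence for infinite
  extensions). [folklore]
-/

noncomputable section

namespace Literature.FieldTheory.Galois

open IntermediateField

/-- **`[Gal(L/K) : Gal(L/M)] = [M : K]`** for a finite Galois subextension `M` of a normal
extension `L/K`: the restriction `Gal(L/K) → Gal(M/K)` is surjective with kernel `Gal(L/M)`.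
[folklore] -/
theorem index_fixingSubgroup_eq_finrank {K L : Type*} [Field K] [Field L] [Algebra K L]
    [Normal K L] (M : IntermediateField K L) [FiniteDimensional K M] [IsGalois K M] :
    M.fixingSubgroup.index = Module.finrank K M := by
  rw [← M.restrictNormalHom_ker, Subgroup.index_ker,
    MonoidHom.range_eq_top.2 (AlgEquiv.restrictNormalHom_surjective L), Subgroup.card_top,
    IsGalois.card_aut_eq_finrank]

/-- **`[Gal(L/k) : Gal(L/M)] = [M : k]`** inside `Gal(L/K)`, for `K ⊆ k ⊆ M ⊆ L` with `L/k` normal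
and `M/k` finite Galois (`M` given as an intermediate field of `L/k`, and `Gal(L/M)` as the fixing
subgroup of `M` viewed over `K`). [folklore] -/
theorem relIndex_fixingSubgroup_restrictScalars_eq_finrank {K L : Type*} [Field K] [Field L]
    [Algebra K L] (k : IntermediateField K L) [Normal k L] (M : IntermediateField k L)
    [FiniteDimensional k M] [IsGalois k M] :
    (M.restrictScalars K).fixingSubgroup.relIndex k.fixingSubgroup = Module.finrank k M := by
  rw [← index_fixingSubgroup_eq_finrank M, Subgroup.relIndex,
    ← Subgroup.index_map_equiv ((M.restrictScalars K).fixingSubgroup.subgroupOf k.fixingSubgroup)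
      (IntermediateField.fixingSubgroupEquiv k)]
  congr 1
  ext φ
  rw [Subgroup.mem_map]
  constructor
  · rintro ⟨ψ, hψ, rfl⟩
    rw [Subgroup.mem_subgroupOf, IntermediateField.mem_fixingSubgroup_iff] at hψ
    rw [IntermediateField.mem_fixingSubgroup_iff]
    intro x hx
    exact hψ (x : L) hx
  · intro hφ
    rw [IntermediateField.mem_fixingSubgroup_iff] at hφ
    refine ⟨(IntermediateField.fixingSubgroupEquiv k).symm φ, ?_, MulEquiv.apply_symm_apply _ _⟩
    rw [Subgroup.mem_subgroupOf, IntermediateField.mem_fixingSubgroup_iff]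
    intro x hx
    exact hφ x hx

/-- Membership form: `σ ∈ Gal(L/K)` fixing `k` pointwise fixes `M` pointwise iff the corresponding
`k`-automorphism fixes `M`. (Restatement of the definitions, recorded for rewriting.) [folklore] -/
theorem mem_fixingSubgroup_restrictScalars_iff {K L : Type*} [Field K] [Field L] [Algebra K L]
    (k : IntermediateField K L) (M : IntermediateField k L) (σ : L ≃ₐ[K] L) :
    σ ∈ (M.restrictScalars K).fixingSubgroup ↔ ∀ x : L, x ∈ M → σ x = x := by
  rw [IntermediateField.mem_fixingSubgroup_iff]
  rfl

end Literature.FieldTheory.Galois
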